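/-
Copyright (c) 2026 the pub-hodgecm-mathlib formalisation cell (harness21).  Prover seat hodgecm-mathlib-K2E1-p15 (g3), Track B ∕ K2-LIT, h413 = `stmt-HodgeConjecture-24833`,
R90-TF section S8 «ContSpec-n½» (planner R90-CS-plan (g0), hand «J3 v2 (2b)(2c)» 2026-09-04T16:19:34Z; this seat's census 16:20:41Z): the ONLY weight-generic non-vanishing of the
`χ`-weighted local ∕ archimedean intertwining factors of `U(J₂)` that is TRUE — the CONSTANT-WEIGHT case (the `ε = χ|_{𝕀_F} = 1` case via the det-twist) — in ★ p861744's token shapes.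
-/
import Summits.HodgeConjecture.HodgeConjecture.Theorems.K2E1ChiIntertwiningLocalFactorHolomorphicU2   -- ★ p861744 (R90-CS-p03): the `χ`-weighted means (weight `ω` abstract), `chiLocalScalar_ne_zero_of_half_lt_re`; brings ★ `K2E1IntertwiningLocalFactorIntegrableU2` (`localMean_one_ne_zero`, `archMean_one_ne_zero`)
import HarnessLib

/-!
# J3 v2 — `K2E1ChiIntertwiningLocalFactorNonvanishingU2`: for a CONSTANT weight `ω ≡ c ≠ 0` the `χ`-weighted local mean `m_v(1)` and archimedean mean `c_∞(1)` of the `U(J₂)`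
# intertwining scalar are `c` times the spherical means, hence NON-ZERO at `z = 1`

Track B ∕ K2-LIT, crux h413 = `stmt-HodgeConjecture-24833`, route of record `HCCMUnconditional`; cell `hodgecm-mathlib`, R90-TF programme, section S8 «ContSpec-n½», socket #4 road
(J3: the factor `A(z) = c_∞(z)·∏_{v∈S} m_v(z)` of K2E1-p10's J2 currency `r = A 1 · G 1`).  THEOREMS ONLY (no `def`, no `instance`, no notation, no named-fact hypothesis, no `sorry`;
default heartbeats); lane `--supports stmt-HodgeConjecture-24833 --as helper` (count-neutral).  Closes no socket.

HONEST SCOPE — READ FIRST.  ★ p861744 types the `χ`-weighted means with an ABSTRACT measurable weight `ω`, `‖ω‖ ≤ 1` (the true token — the value of `χ_w` on the torus part of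
`w₀ n(tδ)` — is the dropped junction J1b).  **For an arbitrary such `ω` the means CAN VANISH at `z = 1`** (a `{+1, −c}`-valued weight on `𝒪_v` ∕ `F_v ∖ 𝒪_v` cancels the two finite positive
partial integrals), so NO `∀ ω` non-vanishing theorem is stated here.  What the #4 road needs is only the case `ε := χ|_{𝕀_F} = 1`: then `χ = ψ̃` for an automorphic `ψ` of `U(1)`
(★ `K2E1ChiDetCharTorusDescentU2`, idelic Hilbert 90), the `χ`-sections are the det-twists `Θ · f₁`, `Θ = ψ∘det` (★ `K2E1ChiEisensteinDetTwistU2`: `Θ` kills `N(𝔸)` and `G(F)`, `E(f·Θ) = Θ·E(f)`,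
residue at `z = 1` = `Θ ·` spherical residue), and along the big cell the weight is the CONSTANT unimodular `ψ_v(det w₀)` — so the relevant non-vanishing is the constant-weight one, `c ·`
(★ spherical positivity `localMean_one_ne_zero` ∕ `archMean_one_ne_zero`).  For `ε ≠ 1` the #4 road needs nothing here (`G 1 = 0`, ★ p861632 §4, kills the residue whatever `A 1` is).

THE MATHEMATICS ([Langlands1976, Appendix]; [MoeglinWaldspurger1995, IV.1.11]; [Rogawski1990, §13.3 p. 202, §13.9 p. 229]).  `∫ c · P^{−z} = c · ∫ P^{−z}` (linearity); at `z = 1` the spherical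
local mean `ν(𝒪_v)⁻¹∫_{L⁺_v} P_v^{−1}` and archimedean mean `μ_E(D_∞)⁻¹∫ A^{−1}` are positive reals (★), so `c ≠ 0` times them is non-zero.
* §1 `const_mul_integral_const_mul`, `const_mul_integral_const_mul_ne_zero` — generic linearity ∕ non-vanishing transport (any measure space, any integrand).
* §2 **`chiLocalMean_const_eq`**, **`chiLocalMean_const_one_ne_zero`** — p861744's §2 token with `ω := fun _ => c`: `= c ·` spherical local mean; `≠ 0` at `z = 1` for `c ≠ 0`.
* §3 **`chiArchMean_const_eq`**, **`chiArchMean_const_one_ne_zero`** — the archimedean twins (p861744 §3 token).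
HONEST LABEL: HC_CM is proved only modulo the 7 printed citations (2 remaining named inputs: hLiu418 = `stmt-HodgeConjecture-24832`, h413 = `stmt-HodgeConjecture-24833`) until
rung 0 closes; REL ≠ ★ ≠ BUILT; this file asserts no named fact and closes no socket; count-neutral.

## References
* [Langlands1976] R. P. Langlands, *On the Functional Equations Satisfied by Eisenstein Series*, LNM 544 (1976), Appendix (rank one).
* [MoeglinWaldspurger1995] C. Mœglin, J.-L. Waldspurger, *Spectral Decomposition and Eisenstein Series* (1995), IV.1.11.
* [Rogawski1990] J. D. Rogawski, *Automorphic Representations of Unitary Groups in Three Variables* (1990), §13.3 p. 202 (`χ∘det`), §13.9 p. 229.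
-/

set_option autoImplicit false
set_option linter.dupNamespace false -- the mandated namespace repeats `HodgeConjecture.HodgeConjecture`

noncomputable section

open MeasureTheory Measure NumberField NumberField.InfinitePlace NumberField.mixedEmbedding IsDedekindDomain IsDedekindDomain.HeightOneSpectrum Set Filter Function Topology Metric
open scoped ENNReal NNReal Classical
open Literature.NumberTheory.GaloisRepresentations.IsNonarchimedeanLocalField
open Literature.NumberTheory.Automorphic Literature.NumberTheory.Automorphic.UnitaryGroup AdelicGroupData Literature.NumberTheory.LFunctions
open Summit.HodgeConjecture.HodgeConjecture.Cruxes.H413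
open Summit.HodgeConjecture.HodgeConjecture.Cruxes.H413.K2E1IntertwiningLocalFactorIntegrableU2 (localMean_one_ne_zero archMean_one_ne_zero)

namespace Summit.HodgeConjecture.HodgeConjecture.Cruxes.H413.K2E1ChiIntertwiningLocalFactorNonvanishingU2

/-! ## §1 Generic: a constant weight pulls out of the mean -/

section Generic

variable {X : Type*} [MeasurableSpace X] {m : Measure X}

/-- `K · ∫ c·f = c · (K · ∫ f)` (linearity of the Bochner integral, Mathlib `integral_const_mul`). [folklore] -/
theorem const_mul_integral_const_mul (f : X → ℂ) (K c : ℂ) :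
    K * ∫ x, c * f x ∂m = c * (K * ∫ x, f x ∂m) := by
  rw [integral_const_mul, mul_left_comm]

/-- `K · ∫ f ≠ 0` and `c ≠ 0` ⟹ `K · ∫ c·f ≠ 0`. [folklore] -/
theorem const_mul_integral_const_mul_ne_zero (f : X → ℂ) (K : ℂ) {c : ℂ} (hc : c ≠ 0) (h : K * ∫ x, f x ∂m ≠ 0) :
    K * ∫ x, c * f x ∂m ≠ 0 := by
  rw [const_mul_integral_const_mul]
  exact mul_ne_zero hc h

end Generic

/-! ## §2 The `χ`-weighted LOCAL mean with constant weight -/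

section Local

variable (L : Type) [Field L] [NumberField L] [IsCMField L] {δ : L} (hδ : δ ≠ 0)

omit [IsCMField L] in
/-- **Constant weight, local**: p861744's `χ`-weighted local mean `ν(𝒪_v)⁻¹·∫ ω_v·P_v^{−z}` with `ω_v ≡ c` equals `c ·` the spherical local mean `ν(𝒪_v)⁻¹·∫ P_v^{−z}` (any `z`, any `c`).
[cite: Langlands1976, Appendix] -/
theorem chiLocalMean_const_eq (v : HeightOneSpectrum (𝓞 ↥(maximalRealSubfield L)))
    [MeasurableSpace (v.adicCompletion ↥(maximalRealSubfield L))] (μ : Measure (v.adicCompletion ↥(maximalRealSubfield L))) (c z : ℂ) :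
    ((((μ (v.adicCompletionIntegers ↥(maximalRealSubfield L))).toReal⁻¹ : ℝ)) : ℂ) *
      ∫ t : v.adicCompletion ↥(maximalRealSubfield L), c * ((((letI := Extension.fintype (𝓞 ↥(maximalRealSubfield L)) ↥(maximalRealSubfield L) L (𝓞 L) v; ∏ w : v.Extension (𝓞 L), max 1 (normAbs (w.1.adicCompletion L) (Extension.adicCompletionSemialgHom ↥(maximalRealSubfield L) L w t) * normAbs (w.1.adicCompletion L) ((algebraMap L (FiniteAdeleRing (𝓞 L) L) δ) w.1))) : ℝ≥0) : ℝ) : ℂ) ^ (-z) ∂μ =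
    c * (((((μ (v.adicCompletionIntegers ↥(maximalRealSubfield L))).toReal⁻¹ : ℝ)) : ℂ) *
      ∫ t : v.adicCompletion ↥(maximalRealSubfield L), ((((letI := Extension.fintype (𝓞 ↥(maximalRealSubfield L)) ↥(maximalRealSubfield L) L (𝓞 L) v; ∏ w : v.Extension (𝓞 L), max 1 (normAbs (w.1.adicCompletion L) (Extension.adicCompletionSemialgHom ↥(maximalRealSubfield L) L w t) * normAbs (w.1.adicCompletion L) ((algebraMap L (FiniteAdeleRing (𝓞 L) L) δ) w.1))) : ℝ≥0) : ℝ) : ℂ) ^ (-z) ∂μ) :=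
  const_mul_integral_const_mul _ _ _

include hδ in
/-- **`m_v^χ(1) ≠ 0` for a constant weight `ω_v ≡ c`, `c ≠ 0`** (the `ε = 1` ∕ det-twist case, `c = ψ_v(det w₀)`): `c ·` ★ `localMean_one_ne_zero` (positivity of the spherical local mean
at `z = 1`).  No `∀ ω` version exists (module docstring). [cite: Langlands1976, Appendix] [cite: Rogawski1990, §13.9 p. 229] -/
theorem chiLocalMean_const_one_ne_zero (v : HeightOneSpectrum (𝓞 ↥(maximalRealSubfield L)))
    [MeasurableSpace (v.adicCompletion ↥(maximalRealSubfield L))] [BorelSpace (v.adicCompletion ↥(maximalRealSubfield L))]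
    (μ : Measure (v.adicCompletion ↥(maximalRealSubfield L))) [μ.IsAddHaarMeasure] {c : ℂ} (hc : c ≠ 0) :
    ((((μ (v.adicCompletionIntegers ↥(maximalRealSubfield L))).toReal⁻¹ : ℝ)) : ℂ) *
      ∫ t : v.adicCompletion ↥(maximalRealSubfield L), c * ((((letI := Extension.fintype (𝓞 ↥(maximalRealSubfield L)) ↥(maximalRealSubfield L) L (𝓞 L) v; ∏ w : v.Extension (𝓞 L), max 1 (normAbs (w.1.adicCompletion L) (Extension.adicCompletionSemialgHom ↥(maximalRealSubfield L) L w t) * normAbs (w.1.adicCompletion L) ((algebraMap L (FiniteAdeleRing (𝓞 L) L) δ) w.1))) : ℝ≥0) : ℝ) : ℂ) ^ (-(1 : ℂ)) ∂μ ≠ 0 :=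
  const_mul_integral_const_mul_ne_zero _ _ hc (localMean_one_ne_zero L hδ v μ)

end Local

/-! ## §3 The `χ`-weighted ARCHIMEDEAN mean with constant weight -/

section Arch

variable (L : Type) [Field L] [NumberField L] [IsCMField L] {δ : L} (hδ : δ ≠ 0)

omit [IsCMField L] in
/-- **Constant weight, archimedean**: p861744's `χ`-weighted archimedean mean `μ_E(D_∞)⁻¹·∫ ω_∞·A^{−z}` with `ω_∞ ≡ c` equals `c ·` the spherical archimedean mean (any `z`, any `c`).
[cite: MoeglinWaldspurger1995, IV.1.11] -/
theorem chiArchMean_const_eq (μE : Measure (mixedSpace ↥(maximalRealSubfield L))) (c z : ℂ) :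
    ((((μE (ZSpan.fundamentalDomain (latticeBasis ↥(maximalRealSubfield L)))).toReal⁻¹ : ℝ)) : ℂ) *
      ∫ s : mixedSpace ↥(maximalRealSubfield L), c * (((∏ w : InfinitePlace L, ((1 : ℝ) + (w δ) ^ 2 * (s.1 ⟨w.comap (algebraMap ↥(maximalRealSubfield L) L), K2E1HeightBigCellLineFormulaU2.isReal_comap_maximalRealSubfield L w⟩) ^ 2)) : ℝ) : ℂ) ^ (-z) ∂μE =
    c * (((((μE (ZSpan.fundamentalDomain (latticeBasis ↥(maximalRealSubfield L)))).toReal⁻¹ : ℝ)) : ℂ) *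
      ∫ s : mixedSpace ↥(maximalRealSubfield L), (((∏ w : InfinitePlace L, ((1 : ℝ) + (w δ) ^ 2 * (s.1 ⟨w.comap (algebraMap ↥(maximalRealSubfield L) L), K2E1HeightBigCellLineFormulaU2.isReal_comap_maximalRealSubfield L w⟩) ^ 2)) : ℝ) : ℂ) ^ (-z) ∂μE) :=
  const_mul_integral_const_mul _ _ _

include hδ in
/-- **`c_∞^χ(1) ≠ 0` for a constant weight `ω_∞ ≡ c`, `c ≠ 0`**: `c ·` ★ `archMean_one_ne_zero` (positivity of the spherical archimedean mean at `z = 1`).  No `∀ ω` version exists.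
[cite: MoeglinWaldspurger1995, IV.1.11] [cite: Rogawski1990, §13.9 p. 229] -/
theorem chiArchMean_const_one_ne_zero (μE : Measure (mixedSpace ↥(maximalRealSubfield L))) [μE.IsAddHaarMeasure] {c : ℂ} (hc : c ≠ 0) :
    ((((μE (ZSpan.fundamentalDomain (latticeBasis ↥(maximalRealSubfield L)))).toReal⁻¹ : ℝ)) : ℂ) *
      ∫ s : mixedSpace ↥(maximalRealSubfield L), c * (((∏ w : InfinitePlace L, ((1 : ℝ) + (w δ) ^ 2 * (s.1 ⟨w.comap (algebraMap ↥(maximalRealSubfield L) L), K2E1HeightBigCellLineFormulaU2.isReal_comap_maximalRealSubfield L w⟩) ^ 2)) : ℝ) : ℂ) ^ (-(1 : ℂ)) ∂μE ≠ 0 :=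
  const_mul_integral_const_mul_ne_zero _ _ hc (archMean_one_ne_zero L hδ μE)

end Arch

end Summit.HodgeConjecture.HodgeConjecture.Cruxes.H413.K2E1ChiIntertwiningLocalFactorNonvanishingU2

end
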